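import Summits.Ventures.CertifiedManyBodySolver.Theorems.TcThermcert1FarCutGeometry
import Summits.Ventures.CertifiedManyBodySolver.Theorems.TcThermcert1QbpLocalisation
import Summits.Ventures.CertifiedManyBodySolver.Theorems.TcThermcert1QbpLocalPerturbation
import Summits.Ventures.CertifiedManyBodySolver.Theorems.TcThermcert1QbpWeight
import Literature.MathematicalPhysics.QuantumLattice.QBPWeight
import Mathlib
import HarnessLib

/-!
# Stub B of line `gauge_qbp_far_seam`, assembly part B: the per-bond quantum-belief-propagation estimate

Second assembly file for stub B `stub_farCutCurrent_of_clustering` of line `gauge_qbp_far_seam` (route `TcThermcert1`,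
items `stmt-Ventures-24560` / `stmt-Ventures-26381`). For a union-of-sectors coordinate predicate `p`, a flux `φ` and a collar
radius `r` (`2 ≤ r`, `r + 2 ≤ ⌊L/2⌋`), the sector Gibbs expectation of the plain current through a bond of the antipodal cut
moves, when the flux is switched on (`H(φ) = H(0) + V_φ`, `V_φ = seamTwist L φ`, `‖V_φ‖ ≤ 4L|φ|`), by at most
`e^{β‖V‖} (C⁺ R² (L²)^k e^{-(⌊L/2⌋-1-r)/ξ} + 16 R δ)`
(`norm_sectorGibbs_farBond_flux_sub_le_of_conjugation`: `E` a conjugation of the Gibbs weights in every subalgebra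
`∋ H(0), V`, `Ẽ` in every subalgebra `∋ H_{X_r}, V`, `‖E‖,‖Ẽ‖ ≤ R`, `‖E-Ẽ‖ ≤ δ`; `Ẽ` is then even and supported in the
collar (part 7a), commutes with the far current, `ẼᴴẼ` is an admissible test observable of Hypothesis C at distance
`⌊L/2⌋-1-r`, and part 5 `norm_gibbsState_block_perturbed_sub_le` applies), and, with `E, Ẽ` produced by quantum belief
propagation (part 6 `exists_qbp_conjugation_pair`, Literature weight `f_β`: `‖f_β‖₁ = 1`, kernel identity, tail
`≤ e^{-πT/β}`) from a uniform leakage bound `ε` of the seam dynamics out of the collar on `|t| ≤ T`,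
`R = e^{β‖V‖/2}`, `δ = (β/2)(ε + 2‖V‖e^{-πT/β})e^{β‖V‖}` (`norm_sectorGibbs_farBond_flux_sub_le_of_leakage`).
Source: Capel–Moscolari–Teufel–Wessel, CMP 406 (2025) 43 = arXiv:2310.09182, Prop. 6, Thm. 14 (fermionic remark p. 12);
design as in parts 5–6 (restricted dynamics instead of a conditional expectation; QBP on the full space, compressed after).
SC in the Hubbard model is NOT proved by anything in this file; K1′/K1 are stiffness CEILINGS conditional on the bet C8.
-/

noncomputable section

open Filter Topology Set Real Matrix Finset MeasureTheory
open scoped Matrix.Norms.L2Operator ComplexOrder ComplexConjugate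
open Literature.MathematicalPhysics.QuantumLattice
open Literature.Probability.LatticeModels

namespace Summit.Ventures.CertifiedManyBodySolver.Theorems.TcThermcert1.GaugeQbpFarSeam

/-! ## §3 The per-bond quantum-belief-propagation estimate (CMTW Thm 14 on the sector, localised by restricted dynamics) -/

section PerBond

variable (L : ℕ) [NeZero L]

/-- **Per-bond LPPL estimate, algebraic core.** Given a union-of-sectors predicate `p`, a flux `φ`, a collar radius `r ≥ 2`
with `r + 2 ≤ ⌊L/2⌋`, a conjugation `E` of the flux-free Gibbs weight into the flux-`φ` one lying in every subalgebra
containing `H(0)` and `V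
    = seamTwist L φ`, a second matrix `Ẽ` lying in every subalgebra containing the collar-restricted
Hamiltonian and `V`, norm bounds `‖E‖, ‖Ẽ‖ ≤ R`, `‖E − Ẽ‖
    ≤ δ`, and the clustering hypothesis of the line at this volume,
the sector Gibbs expectation of the plain current through the bond `(⌊L/2⌋-1, y)–(⌊L/2⌋, y)` moves, when the flux is
switched on, by at most `e^{β‖V‖} (C⁺ R² (L²)^k e^{-(⌊L/2⌋-1-r)/ξ} + 16 R δ)`: `Ẽ` is even and supported in the collar
(so it commutes with the far current and `ẼᴴẼ` is an admissible test observable at distance `⌊L/2⌋-1-r`), and part 5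
(`norm_gibbsState_block_perturbed_sub_le`) applies. [cite: CapelEtAl2023, Theorem 14; arXiv:2310.09182] -/
theorem norm_sectorGibbs_farBond_flux_sub_le_of_conjugation
    (p : Finset (Orb (FermionTorus 2 L)) → Prop) [DecidablePred p]
    (hp : ∀ X : Matrix (Finset (Orb (FermionTorus 2 L))) (Finset (Orb (FermionTorus 2 L))) ℂ,
      PreservesSectors X → ∀ s t, p s → ¬ p t → X s t = 0 ∧ X t s = 0)
    (U : ℝ) {β : ℝ} (hβ : 0 ≤ β) (φ : ℝ) {ξ C : ℝ} {k r : ℕ} (hr : 2 ≤ r) (hrL : r + 2 ≤ L / 2)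
    {E Et : Matrix (Finset (Orb (FermionTorus 2 L))) (Finset (Orb (FermionTorus 2 L))) ℂ} {R δ : ℝ}
    (hW : gibbsWeight β (hubbardTorusTT'Flux L 0 U 0 + seamTwist L φ) =
      E * gibbsWeight β (hubbardTorusTT'Flux L 0 U 0) * Eᴴ)
    (hEn : ‖E‖ ≤ R) (hEtn : ‖Et‖ ≤ R) (hδ : ‖E - Et‖ ≤ δ)
    (hES : ∀ S : Subalgebra ℂ (Matrix (Finset (Orb (FermionTorus 2 L))) (Finset (Orb (FermionTorus 2 L))) ℂ),
      hubbardTorusTT'Flux L 0 U 0 ∈ S → seamTwist L φ ∈ S → E ∈ S)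
    (hEtS : ∀ S : Subalgebra ℂ (Matrix (Finset (Orb (FermionTorus 2 L))) (Finset (Orb (FermionTorus 2 L))) ℂ),
      (∑ Z ∈ Finset.univ.filter (fun Z : HubbardIdx (fermionTorusGraph 2 L) =>
          hubbardTermSupp (fermionTorusGraph 2 L) Z ⊆
            Finset.univ.filter (fun x : FermionTorus 2 L => (FermionTorus.toTorusSite x 0).valMinAbs.natAbs ≤ r)),
        hubbardTermOp (fermionTorusGraph 2 L) 1 U 0 Z) ∈ S → seamTwist L φ ∈ S → Et ∈ S)
    (hC : ∀ (X : Finset (FermionTorus 2 L))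
        (A : Matrix (Finset (Orb (FermionTorus 2 L))) (Finset (Orb (FermionTorus 2 L))) ℂ),
        A ∈ carEvenSubalgebra (orbSet X) → (∀ s t, p s → ¬ p t → A s t = 0 ∧ A t s = 0) →
        ∀ (X₀ y : ZMod L) (d : ℕ),
          (∀ x ∈ X, d ≤ torusDist x.toTorusSite ![X₀, y] ∧
            d ≤ torusDist x.toTorusSite ![X₀ - 1, y]) →
          ‖gibbsState β ((hubbardTorusTT'Flux L 0 U 0).toBlock p p)
                ((A * ∑ σ : Fin 2,
                    ((-Complex.I) • (creation (orb (FermionTorus.ofTorusSite ![X₀, y]) σ) *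
                        annihilation (orb (FermionTorus.ofTorusSite ![X₀ - 1, y]) σ)) +
                      Complex.I • (creation (orb (FermionTorus.ofTorusSite ![X₀ - 1, y]) σ) *
                        annihilation (orb (FermionTorus.ofTorusSite ![X₀, y]) σ)))).toBlock p p)
              - gibbsState β ((hubbardTorusTT'Flux L 0 U 0).toBlock p p) (A.toBlock p p) *
                gibbsState β ((hubbardTorusTT'Flux L 0 U 0).toBlock p p)
                  ((∑ σ : Fin 2,
                    ((-Complex.I) • (creation (orb (FermionTorus.ofTorusSite ![X₀, y]) σ) *
                        annihilation (orb (FermionTorus.ofTorusSite ![X₀ - 1, y]) σ)) +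
                      Complex.I • (creation (orb (FermionTorus.ofTorusSite ![X₀ - 1, y]) σ) *
                        annihilation (orb (FermionTorus.ofTorusSite ![X₀, y]) σ)))).toBlock p p)‖
            ≤ C * ‖A‖ * (X.card : ℝ) ^ k * Real.exp (-(d : ℝ) / ξ))
    (y : ZMod L) :
    ‖gibbsState β ((hubbardTorusTT'Flux L 0 U φ).toBlock p p)
          ((∑ σ : Fin 2,
              ((-Complex.I) • (creation (orb (FermionTorus.ofTorusSite ![((L / 2 : ℕ) : ZMod L), y]) σ) *
                  annihilation (orb (FermionTorus.ofTorusSite ![((L / 2 : ℕ) : ZMod L) - 1, y]) σ)) +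
                Complex.I • (creation (orb (FermionTorus.ofTorusSite ![((L / 2 : ℕ) : ZMod L) - 1, y]) σ) *
                  annihilation (orb (FermionTorus.ofTorusSite ![((L / 2 : ℕ) : ZMod L), y]) σ)))).toBlock p p) -
        gibbsState β ((hubbardTorusTT'Flux L 0 U 0).toBlock p p)
          ((∑ σ : Fin 2,
              ((-Complex.I) • (creation (orb (FermionTorus.ofTorusSite ![((L / 2 : ℕ) : ZMod L), y]) σ) *
                  annihilation (orb (FermionTorus.ofTorusSite ![((L / 2 : ℕ) : ZMod L) - 1, y]) σ)) +
                Complex.I • (creation (orb (FermionTorus.ofTorusSite ![((L / 2 : ℕ) : ZMod L) - 1, y]) σ) *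
                  annihilation (orb (FermionTorus.ofTorusSite ![((L / 2 : ℕ) : ZMod L), y]) σ)))).toBlock p p)‖ ≤
      Real.exp (β * ‖seamTwist L φ‖) *
        (max C 0 * R ^ 2 * ((L : ℝ) ^ 2) ^ k * Real.exp (-((L / 2 - 1 - r : ℕ) : ℝ) / ξ) + 4 * R * δ * 4) := by
  -- abbreviations (opaque names with defining equations)
  obtain ⟨Xc, hXc⟩ : ∃ Xc : Finset (FermionTorus 2 L),
      Xc = Finset.univ.filter (fun x : FermionTorus 2 L => (FermionTorus.toTorusSite x 0).valMinAbs.natAbs ≤ r) :=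
    ⟨_, rfl⟩
  rw [← hXc] at hEtS
  obtain ⟨J, hJ⟩ : ∃ J : Matrix (Finset (Orb (FermionTorus 2 L))) (Finset (Orb (FermionTorus 2 L))) ℂ,
      J = ∑ σ : Fin 2,
        ((-Complex.I) • (creation (orb (FermionTorus.ofTorusSite (![((L / 2 : ℕ) : ZMod L), y] : TorusSite 2 L)) σ) *
            annihilation (orb (FermionTorus.ofTorusSite (![((L / 2 : ℕ) : ZMod L) - 1, y] : TorusSite 2 L)) σ)) +
          Complex.I • (creation (orb (FermionTorus.ofTorusSite (![((L / 2 : ℕ) : ZMod L) - 1, y] : TorusSite 2 L)) σ) *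
            annihilation (orb (FermionTorus.ofTorusSite (![((L / 2 : ℕ) : ZMod L), y] : TorusSite 2 L)) σ))) :=
    ⟨_, rfl⟩
  rw [← hJ]
  have hH0 : (hubbardTorusTT'Flux L 0 U 0).IsHermitian := isHermitian_hubbardTorusTT'Flux L 0 U 0
  have hV : (seamTwist L φ).IsHermitian := isHermitian_seamTwist L φ
  have hR0 : 0 ≤ R := (norm_nonneg _).trans hEn
  have hδ0 : 0 ≤ δ := (norm_nonneg _).trans hδ
  -- sector preservation (7a + the instance transport)
  have hH0p := hp _ (preservesSectors_hubbardTorusTT'Flux L 0 U 0)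
  have hVp := hp _ (preservesSectors_seamTwist L φ)
  have hEp := hp _ (preservesSectors_of_forall_subalgebra_mem
    (fun S h1 h2 => forall_subalgebra_mem_of_subsingleton hES S h1 h2)
    (preservesSectors_hubbardTorusTT'Flux L 0 U 0) (preservesSectors_seamTwist L φ))
  have hEtp := hp _ (preservesSectors_of_forall_subalgebra_mem
    (fun S h1 h2 => forall_subalgebra_mem_of_subsingleton hEtS S h1 h2)
    (preservesSectors_sum_hubbardTermOp _ 1 U 0 _) (preservesSectors_seamTwist L φ))
  have hJP : PreservesSectors J := by
    rw [hJ]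
    exact PreservesSectors.sum fun σ _ =>
      ((LiebThm1.preservesSectors_hopping _ _ σ).smul _).add ((LiebThm1.preservesSectors_hopping _ _ σ).smul _)
  have hJp := hp _ hJP
  -- locality of the restricted conjugation and commutation with the far current
  have hseam : ∀ y' : ZMod L, FermionTorus.ofTorusSite (![0, y'] : TorusSite 2 L) ∈ Xc ∧
      FermionTorus.ofTorusSite (![-1, y'] : TorusSite 2 L) ∈ Xc := fun y' => by
    rw [hXc]; exact seamColumns_mem_collar L hr y'
  have hEt_mem : Et ∈ carEvenSubalgebra (orbSet Xc) :=
    forall_subalgebra_mem_of_subsingleton hEtS _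
      (sum_hubbardTermOp_mem_carEvenSubalgebra _ 1 U 0 (fun Z hZ => (Finset.mem_filter.1 hZ).2))
      (seamTwist_mem_carEvenSubalgebra L φ hseam)
  have hJ_mem : J ∈ carEvenSubalgebra (orbSet ({FermionTorus.ofTorusSite (![((L / 2 : ℕ) : ZMod L), y] : TorusSite 2 L),
      FermionTorus.ofTorusSite (![((L / 2 : ℕ) : ZMod L) - 1, y] : TorusSite 2 L)} : Finset (FermionTorus 2 L))) := by
    rw [hJ]
    exact farBond_mem_carEvenSubalgebra (by simp) (by simp)
  have hdisj := disjoint_collar_farBond L hrL y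
  rw [← hXc] at hdisj
  have hcomm : Et * J = J * Et := (commute_of_mem_carEvenSubalgebra_orbSet hEt_mem hJ_mem hdisj).eq
  -- the test observable `Ẽᴴ Ẽ` and the clustering hypothesis
  have hA_mem : Etᴴ * Et ∈ carEvenSubalgebra (orbSet Xc) := conjTranspose_mul_self_mem_carEvenSubalgebra hEt_mem
  have hAp := sectorPreserving_mul p (sectorPreserving_conjTranspose p hEtp) hEtp
  have hdist : ∀ x ∈ Xc, L / 2 - 1 - r ≤ torusDist x.toTorusSite ![((L / 2 : ℕ) : ZMod L), y] ∧
      L / 2 - 1 - r ≤ torusDist x.toTorusSite ![((L / 2 : ℕ) : ZMod L) - 1, y] := by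
    intro x hx
    rw [hXc] at hx
    exact farBond_dist_of_mem_collar L (Finset.mem_filter.1 hx).2 y
  have hcov := hC Xc (Etᴴ * Et) hA_mem hAp (((L / 2 : ℕ) : ZMod L)) y (L / 2 - 1 - r) hdist
  rw [← hJ] at hcov
  -- sizes
  have hEtEt : ‖Etᴴ * Et‖ ≤ R ^ 2 := by
    rw [l2_opNorm_conjTranspose_mul_self, sq]
    exact mul_le_mul hEtn hEtn (norm_nonneg _) hR0
  have hXcard : (Xc.card : ℝ) ≤ (L : ℝ) ^ 2 := by
    have h := Finset.card_le_univ Xc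
    rw [card_fermionTorus_two] at h
    exact_mod_cast h
  have hnn : 0 ≤ ‖Etᴴ * Et‖ := norm_nonneg _
  have hcov' : ‖gibbsState β ((hubbardTorusTT'Flux L 0 U 0).toBlock p p) ((Etᴴ * Et * J).toBlock p p) -
      gibbsState β ((hubbardTorusTT'Flux L 0 U 0).toBlock p p) ((Etᴴ * Et).toBlock p p) *
        gibbsState β ((hubbardTorusTT'Flux L 0 U 0).toBlock p p) (J.toBlock p p)‖ ≤
      max C 0 * R ^ 2 * ((L : ℝ) ^ 2) ^ k * Real.exp (-((L / 2 - 1 - r : ℕ) : ℝ) / ξ) := by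
    refine hcov.trans ?_
    have hM : 0 ≤ ‖Etᴴ * Et‖ * (Xc.card : ℝ) ^ k * Real.exp (-((L / 2 - 1 - r : ℕ) : ℝ) / ξ) :=
      mul_nonneg (mul_nonneg hnn (pow_nonneg (Nat.cast_nonneg _) k)) (Real.exp_pos _).le
    have h1 : ‖Etᴴ * Et‖ * (Xc.card : ℝ) ^ k * Real.exp (-((L / 2 - 1 - r : ℕ) : ℝ) / ξ) ≤
        R ^ 2 * ((L : ℝ) ^ 2) ^ k * Real.exp (-((L / 2 - 1 - r : ℕ) : ℝ) / ξ) :=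
      mul_le_mul_of_nonneg_right
        (mul_le_mul hEtEt (pow_le_pow_left₀ (Nat.cast_nonneg _) hXcard k) (pow_nonneg (Nat.cast_nonneg _) k)
          (sq_nonneg R))
        (Real.exp_pos _).le
    calc C * ‖Etᴴ * Et‖ * (Xc.card : ℝ) ^ k * Real.exp (-((L / 2 - 1 - r : ℕ) : ℝ) / ξ)
        = C * (‖Etᴴ * Et‖ * (Xc.card : ℝ) ^ k * Real.exp (-((L / 2 - 1 - r : ℕ) : ℝ) / ξ)) := by ring
      _ ≤ max C 0 * (R ^ 2 * ((L : ℝ) ^ 2) ^ k * Real.exp (-((L / 2 - 1 - r : ℕ) : ℝ) / ξ)) :=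
          mul_le_mul (le_max_left _ _) h1 hM (le_max_right _ _)
      _ = _ := by ring
  -- part 5 (canonical-sector LPPL estimate)
  have main := norm_gibbsState_block_perturbed_sub_le p hH0 hV hβ hH0p hVp hEp hEtp hJp hW hEn hEtn hδ hcomm hcov'
  have hJn : ‖J‖ ≤ 4 := by
    rw [hJ]
    exact norm_le_of_subsingleton (norm_farBond_le _ _)
  rw [hubbardTorusTT'Flux_zero_eq_add_seamTwist L U φ]
  refine main.trans (mul_le_mul_of_nonneg_left (add_le_add le_rfl ?_) (Real.exp_pos _).le)
  exact mul_le_mul_of_nonneg_left hJn (mul_nonneg (mul_nonneg (by norm_num) hR0) hδ0)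

/-- **Per-bond LPPL estimate with the QBP weight `f_β`.** As above, with `E`, `Ẽ` produced by quantum belief propagation
(part 6, `exists_qbp_conjugation_pair`, weight `f_β` of ‖f_β‖₁
    = 1 and tail `≤ e^{-πT/β}`) from a uniform bound `ε` on the
leakage of the seam dynamics out of the collar on `|t| ≤ T`: the flux moves the far bond current by at most
`e^{β‖V‖} (C⁺ e^{β‖V‖} (L²)^k e^{-(⌊L/2⌋-1-r)/ξ} + 16 e^{β‖V‖/2} (β/2)(ε + 2‖V‖e^{-πT/β}) e^{β‖V‖})`.
[cite: CapelEtAl2023, Proposition 6 and Theorem 14; arXiv:2310.09182] -/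
theorem norm_sectorGibbs_farBond_flux_sub_le_of_leakage
    (p : Finset (Orb (FermionTorus 2 L)) → Prop) [DecidablePred p]
    (hp : ∀ X : Matrix (Finset (Orb (FermionTorus 2 L))) (Finset (Orb (FermionTorus 2 L))) ℂ,
      PreservesSectors X → ∀ s t, p s → ¬ p t → X s t = 0 ∧ X t s = 0)
    (U : ℝ) {β : ℝ} (hβ : 0 < β) (φ : ℝ) {ξ C : ℝ} {k r : ℕ} (hr : 2 ≤ r) (hrL : r + 2 ≤ L / 2)
    {T ε : ℝ} (hT : 0 ≤ T) (hε0 : 0 ≤ ε)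
    (hε : ∀ s ∈ Icc (0:ℝ) 1, ∀ t : ℝ, |t| ≤ T →
      ‖heisenbergEvolution (hubbardTorusTT'Flux L 0 U 0 + (s : ℂ) • seamTwist L φ) t (seamTwist L φ) -
        heisenbergEvolution
          (∑ Z ∈ Finset.univ.filter (fun Z : HubbardIdx (fermionTorusGraph 2 L) =>
              hubbardTermSupp (fermionTorusGraph 2 L) Z ⊆
                Finset.univ.filter (fun x : FermionTorus 2 L => (FermionTorus.toTorusSite x 0).valMinAbs.natAbs ≤ r)),
            hubbardTermOp (fermionTorusGraph 2 L) 1 U 0 Z + (s : ℂ) • seamTwist L φ) t (seamTwist L φ)‖ ≤ ε)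
    (hC : ∀ (X : Finset (FermionTorus 2 L))
        (A : Matrix (Finset (Orb (FermionTorus 2 L))) (Finset (Orb (FermionTorus 2 L))) ℂ),
        A ∈ carEvenSubalgebra (orbSet X) → (∀ s t, p s → ¬ p t → A s t = 0 ∧ A t s = 0) →
        ∀ (X₀ y : ZMod L) (d : ℕ),
          (∀ x ∈ X, d ≤ torusDist x.toTorusSite ![X₀, y] ∧
            d ≤ torusDist x.toTorusSite ![X₀ - 1, y]) →
          ‖gibbsState β ((hubbardTorusTT'Flux L 0 U 0).toBlock p p)
                ((A * ∑ σ : Fin 2,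
                    ((-Complex.I) • (creation (orb (FermionTorus.ofTorusSite ![X₀, y]) σ) *
                        annihilation (orb (FermionTorus.ofTorusSite ![X₀ - 1, y]) σ)) +
                      Complex.I • (creation (orb (FermionTorus.ofTorusSite ![X₀ - 1, y]) σ) *
                        annihilation (orb (FermionTorus.ofTorusSite ![X₀, y]) σ)))).toBlock p p)
              - gibbsState β ((hubbardTorusTT'Flux L 0 U 0).toBlock p p) (A.toBlock p p) *
                gibbsState β ((hubbardTorusTT'Flux L 0 U 0).toBlock p p)
                  ((∑ σ : Fin 2,
                    ((-Complex.I) • (creation (orb (FermionTorus.ofTorusSite ![X₀, y]) σ) *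
                        annihilation (orb (FermionTorus.ofTorusSite ![X₀ - 1, y]) σ)) +
                      Complex.I • (creation (orb (FermionTorus.ofTorusSite ![X₀ - 1, y]) σ) *
                        annihilation (orb (FermionTorus.ofTorusSite ![X₀, y]) σ)))).toBlock p p)‖
            ≤ C * ‖A‖ * (X.card : ℝ) ^ k * Real.exp (-(d : ℝ) / ξ))
    (y : ZMod L) :
    ‖gibbsState β ((hubbardTorusTT'Flux L 0 U φ).toBlock p p)
          ((∑ σ : Fin 2,
              ((-Complex.I) • (creation (orb (FermionTorus.ofTorusSite ![((L / 2 : ℕ) : ZMod L), y]) σ) *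
                  annihilation (orb (FermionTorus.ofTorusSite ![((L / 2 : ℕ) : ZMod L) - 1, y]) σ)) +
                Complex.I • (creation (orb (FermionTorus.ofTorusSite ![((L / 2 : ℕ) : ZMod L) - 1, y]) σ) *
                  annihilation (orb (FermionTorus.ofTorusSite ![((L / 2 : ℕ) : ZMod L), y]) σ)))).toBlock p p) -
        gibbsState β ((hubbardTorusTT'Flux L 0 U 0).toBlock p p)
          ((∑ σ : Fin 2,
              ((-Complex.I) • (creation (orb (FermionTorus.ofTorusSite ![((L / 2 : ℕ) : ZMod L), y]) σ) *
                  annihilation (orb (FermionTorus.ofTorusSite ![((L / 2 : ℕ) : ZMod L) - 1, y]) σ)) +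
                Complex.I • (creation (orb (FermionTorus.ofTorusSite ![((L / 2 : ℕ) : ZMod L) - 1, y]) σ) *
                  annihilation (orb (FermionTorus.ofTorusSite ![((L / 2 : ℕ) : ZMod L), y]) σ)))).toBlock p p)‖ ≤
      Real.exp (β * ‖seamTwist L φ‖) *
        (max C 0 * Real.exp (β * ‖seamTwist L φ‖) * ((L : ℝ) ^ 2) ^ k *
            Real.exp (-((L / 2 - 1 - r : ℕ) : ℝ) / ξ) +
          4 * Real.exp (β / 2 * ‖seamTwist L φ‖) *
            (β / 2 * (ε + 2 * ‖seamTwist L φ‖ * Real.exp (-(π / β * T))) * Real.exp (β * ‖seamTwist L φ‖)) *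
            4) := by
  have hH0 : (hubbardTorusTT'Flux L 0 U 0).IsHermitian := isHermitian_hubbardTorusTT'Flux L 0 U 0
  have hV : (seamTwist L φ).IsHermitian := isHermitian_seamTwist L φ
  have hH' : (∑ Z ∈ Finset.univ.filter (fun Z : HubbardIdx (fermionTorusGraph 2 L) =>
      hubbardTermSupp (fermionTorusGraph 2 L) Z ⊆
        Finset.univ.filter (fun x : FermionTorus 2 L => (FermionTorus.toTorusSite x 0).valMinAbs.natAbs ≤ r)),
      hubbardTermOp (fermionTorusGraph 2 L) 1 U 0 Z).IsHermitian :=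
    isHermitian_sum_hubbardTermOp _ 1 U 0 _
  -- the weight `f_β` (Literature `QBPWeight`)
  have hf : Integrable (qbpWeight β) := Literature.MathematicalPhysics.QuantumLattice.integrable_qbpWeight hβ
  have hf1 : ∫ t, |qbpWeight β t| = 1 := Literature.MathematicalPhysics.QuantumLattice.integral_abs_qbpWeight hβ
  have htail : ∫ t in {t : ℝ | T < |t|}, |qbpWeight β t| ≤ Real.exp (-(π / β * T)) :=
    setIntegral_abs_qbpWeight_tail_le hβ (fun t => qbpWeight_eq_tsum hβ t) hT
  -- the localised conjugation pair (part 6)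
  obtain ⟨E, Et, hW, hEn, hEtn, hd, hES, hEtS⟩ :=
    exists_qbp_conjugation_pair hH0 hH' hV hβ.le hf
      (Literature.MathematicalPhysics.QuantumLattice.qbpWeight_kernel_identity hβ) (T := T) hε0 hε
  rw [hf1, one_mul] at hEn hEtn hd
  rw [mul_one] at hd
  have hv0 : 0 ≤ ‖seamTwist L φ‖ := norm_nonneg _
  have hδ : ‖E - Et‖ ≤
      β / 2 * (ε + 2 * ‖seamTwist L φ‖ * Real.exp (-(π / β * T))) * Real.exp (β * ‖seamTwist L φ‖) := by
    refine hd.trans (mul_le_mul_of_nonneg_right (mul_le_mul_of_nonneg_left ?_ (by positivity)) (Real.exp_pos _).le)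
    exact add_le_add le_rfl (mul_le_mul_of_nonneg_left htail (mul_nonneg zero_le_two hv0))
  have h := norm_sectorGibbs_farBond_flux_sub_le_of_conjugation L p hp U hβ.le φ (ξ := ξ) (C := C) (k := k) hr hrL
    hW hEn hEtn hδ hES hEtS hC y
  have hR2 : Real.exp (β / 2 * ‖seamTwist L φ‖) ^ 2 = Real.exp (β * ‖seamTwist L φ‖) := by
    rw [sq, ← Real.exp_add]; ring_nf
  rw [hR2] at h
  exact h

end PerBond

end Summit.Ventures.CertifiedManyBodySolver.Theorems.TcThermcert1.GaugeQbpFarSeam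

end
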